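import Summits.BirchSwinnertonDyer.BirchSwinnertonDyer.Theorems.SignedLowerHalvesSmallImageLowerHalfBothSignsRttD2SeqSemilocFrobValue
import Summits.BirchSwinnertonDyer.BirchSwinnertonDyer.Theorems.SignedLowerHalvesSmallImageLowerHalfBothSignsRttD2SeqSemilocUnramified
import Summits.BirchSwinnertonDyer.BirchSwinnertonDyer.Theorems.SignedLowerHalvesSmallImageLowerHalfBothSignsRttD2SeqSemilocTower
import Summits.BirchSwinnertonDyer.BirchSwinnertonDyer.Theorems.SignedLowerHalvesSmallImageLowerHalfBothSignsRttJunctionFrobenius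
import Literature.NumberTheory.Automorphic.AdicCompletionResidueCard
import Literature.NumberTheory.GaloisRepresentations.LocalGaloisGroupProofs
import HarnessLib

/-!
# Route `SignedLowerHalves`, crux L `SmallImageLowerHalfBothSigns` (stmt-BirchSwinnertonDyer-23599), line `rtt_w3` v32 — stub S3β″ (`stub_junctionPT_ns`), input N5-(iii)
# (unramified generator), components C1/C2/C3 AT THE SEMILOCAL LEVEL: Frobenius-valued classes of `Lloc_w(n,k) = H¹(Γ_{K_w}, Maps(Γ_K ⧸ U_n, X_k))`

WIDTH seat `bsd-line-slh-p3-w3` g27 under LEAD `cruxlead-stmt-BirchSwinnertonDyer-23599` g14 (cell `bsd-ssimc`); helper `--supports stmt-BirchSwinnertonDyer-23599`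
(plan `Lines/rtt_w3-DESIGN-N5iii-w3-g26.md` §2). ONE DEFINITION WITH BODY (`semilocGalRep`, an `abbrev` naming the local coinduced module) + THEOREMS; no named fact, no instance,
no `sorry`. HONEST FRAMING: plumbing of the generic Frobenius-value relation (`…RttD2SeqSemilocFrobValue`) onto the semilocal levels: (C1) at a place `w ∉ P` the coinduced
module `Maps(Γ_K ⧸ U_n, X_k)` restricted to `Γ_{K_w}` is finite and its inertia acts trivially (`I_𝔓 ≤ N_P ≤ U_n`, tree `isUnramifiedAt_coind`); (C2) an arithmetic
Frobenius `φ_w ∈ Γ_K` at the prime `𝔓₀` cut out by `K̄ → K̄_w` LIFTS to `φ̃ ∈ Γ_{K_w}` of Frobenius degree one with `res_w φ̃ = φ_w` (tree Frobenius dictionary); (C3/C4-nat)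
the Frobenius-value relation is natural under EVERY transition `semilocH η` of the semilocal tower (corestriction, reduction, `𝒪`-scalars, conjugation), and Frobenius-valued
classes lie in g26's `unramifiedLevelΛ`. Nothing about S3β″, crux L or BSD is proved; all remain OPEN and are proved for NO curve.
References: [NeukirchSchmidtWingberg2008] I §6 (1.6.4), (7.1.2), (8.6.2); [NeukirchANT1999] II §9 Prop. (9.6); [SerreLocalFields1979] XIII §1; [MilneADT2006] I §2 Lemma 2.9.
-/

set_option autoImplicit false
set_option linter.dupNamespace false -- D-0017: single-problem summit, the namespace repeats the problem name by design
noncomputable section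

open scoped Classical
open NumberField IsDedekindDomain Field CategoryTheory Function

namespace Summit.BirchSwinnertonDyer.BirchSwinnertonDyer.Theorems.SmallImageRttD2Seq

open Literature.NumberTheory.EllipticCurves Literature.NumberTheory.GaloisRepresentations Literature.NumberTheory.GaloisRepresentations.DiscreteGaloisModule
  Literature.NumberTheory.ComplexMultiplication.EllipticUnits.JohnsonLeungKings2011
  Summit.BirchSwinnertonDyer.BirchSwinnertonDyer.Theorems.SmallImageRttD2J1
  IsDedekindDomain.HeightOneSpectrum

section Level

variable {K : Type} [Field K] [NumberField K] {p : ℕ} [Fact p.Prime] (S : Set (PadicAlgCl p)) (κ : ZpExtension K p)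
  (θ' : absoluteGaloisGroup K →ₜ* (padicCoeffIntegers S)ˣ) (P : Set (HeightOneSpectrum (𝓞 K))) (w : HeightOneSpectrum (𝓞 K))

/-- **The semilocal coefficient module `Maps(Γ_K ⧸ U_n, X_k)` restricted to `Γ_{K_w}`** as a discrete Galois module of the local field `K_w` (its cohomology in degree `i` is
`semilocCoh S κ θ' P w n k i`, definitionally). [cite: NeukirchSchmidtWingberg2008, I §6 (1.6.4), (8.6.2)] -/
abbrev semilocGalRep (n k : ℕ) :
    DiscreteGaloisModule (w.adicCompletion K)
      (absoluteGaloisGroup K ⧸ κ.layerSubgroup n → ↥(Representation.invariants ((muTwistO S θ' k).toRepresentation.comp (ramificationSubgroup K P).subtype))) :=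
  letI := layerQuotFintype κ n
  GaloisRep.toLocal w (DiscreteGaloisModule.coind (coeffRepK S θ' P k) (κ.layerSubgroup n) (κ.isOpen_layerSubgroup n))

/-- The action of `semilocGalRep` on functions: `(σ ⋆ f)(y) = res σ • f((res σ)⁻¹ • y)`. [cite: NeukirchSchmidtWingberg2008, I §6] -/
theorem semilocGalRep_apply_apply (n k : ℕ) (σ : absoluteGaloisGroup (w.adicCompletion K))
    (f : absoluteGaloisGroup K ⧸ κ.layerSubgroup n → ↥(Representation.invariants ((muTwistO S θ' k).toRepresentation.comp (ramificationSubgroup K P).subtype)))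
    (y : absoluteGaloisGroup K ⧸ κ.layerSubgroup n) :
    semilocGalRep S κ θ' P w n k σ f y =
      coeffRepK S θ' P k (resGalOfEmb (closureEmb (K := K) (w.adicCompletion K)) σ) (f ((resGalOfEmb (closureEmb (K := K) (w.adicCompletion K)) σ)⁻¹ • y)) :=
  rfl

omit [NumberField K] in
/-- (C1) **`Maps(Γ_K ⧸ U_n, X_k)` is finite.** [folklore] -/
theorem finite_semilocCoeff [FiniteDimensional ℚ_[p] (padicCoeffField S)] (n k : ℕ) :
    Finite (absoluteGaloisGroup K ⧸ κ.layerSubgroup n → ↥(Representation.invariants ((muTwistO S θ' k).toRepresentation.comp (ramificationSubgroup K P).subtype))) := by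
  letI := layerQuotFintype κ n
  haveI := finite_oMuCarrier (K := K) S k
  haveI : Finite ↥(Representation.invariants ((muTwistO S θ' k).toRepresentation.comp (ramificationSubgroup K P).subtype)) := Subtype.finite
  exact Pi.finite

/-- (C1) **At `w ∉ P` the inertia group of `K_w` acts trivially on `Maps(Γ_K ⧸ U_n, X_k)`** (`X_k` is unramified off `P`, `I_𝔓 ≤ N_P ≤ U_n`; tree `isUnramifiedAt_coind` +
`isUnramifiedAt_iff_toLocal`). [cite: NeukirchSchmidtWingberg2008, I §6 Prop. (1.6.4), VIII §3] [cite: NeukirchANT1999, II §9 Prop. (9.6)] -/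
theorem semilocGalRep_apply_eq_self_of_mem_absInertia (hw : w ∉ P) (hNP : ∀ n, ramificationSubgroup K P ≤ κ.layerSubgroup n) (n k : ℕ)
    (σ : absoluteGaloisGroup (w.adicCompletion K)) (hσ : σ ∈ absInertia (w.adicCompletion K))
    (f : absoluteGaloisGroup K ⧸ κ.layerSubgroup n → ↥(Representation.invariants ((muTwistO S θ' k).toRepresentation.comp (ramificationSubgroup K P).subtype))) :
    semilocGalRep S κ θ' P w n k σ f = f := by
  letI := layerQuotFintype κ n
  have hur : GaloisRep.IsUnramifiedAt w (DiscreteGaloisModule.coind (coeffRepK S θ' P k) (κ.layerSubgroup n) (κ.isOpen_layerSubgroup n)) :=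
    SignedLowerOffTwo.PTDeep.isUnramifiedAt_coind _ _ _ (isUnramifiedAt_coeffRepK S θ' P k hw) fun 𝔓 h𝔓 ↦ (inertia_le_ramificationSubgroup hw h𝔓).trans (hNP n)
  have h1 := (GaloisRep.isUnramifiedAt_iff_toLocal_holds w (DiscreteGaloisModule.coind (coeffRepK S θ' P k) (κ.layerSubgroup n) (κ.isOpen_layerSubgroup n))).1 hur σ hσ
  exact LinearMap.congr_fun h1 f

/-- (C2) **An arithmetic Frobenius at `𝔓₀ = adicCompletionPrime K w` lifts to `Γ_{K_w}` as an element of Frobenius degree one** (`D_{𝔓₀} = res_w(Γ_{K_w})` and the tree's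
Frobenius dictionary `isArithFrobAt_absGaloisRestrict_adicCompletionPrime_iff`, `isFrobPow_one_iff_isAbsArithFrob`). [cite: NeukirchANT1999, II §9 Prop. (9.6)] [cite: SerreLocalFields1979, XIII §1] -/
theorem exists_isFrobPow_one_resGalOfEmb_eq {φ : absoluteGaloisGroup K} (hφ : IsArithFrobAt (𝓞 K) φ (adicCompletionPrime K w)) :
    ∃ φl : absoluteGaloisGroup (w.adicCompletion K), IsFrobPow φl 1 ∧ resGalOfEmb (closureEmb (K := K) (w.adicCompletion K)) φl = φ := by
  have hD : φ ∈ (adicCompletionPrime K w).decompositionSubgroup (absoluteGaloisGroup K) := hφ.mem_stabilizer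
  rw [decompositionSubgroup_adicCompletionPrime_eq_range] at hD
  obtain ⟨φl, hφl⟩ := hD
  have hq : IsNonarchimedeanLocalField.residueFieldCard (w.adicCompletion K) = Nat.card (𝓞 K ⧸ w.asIdeal) :=
    (Literature.NumberTheory.Automorphic.residueFieldCard_adicCompletion_eq K w).trans w.residueCard_eq_card_quotient
  refine ⟨φl, isFrobPow_one_iff_isAbsArithFrob_holds.mpr ?_, hφl⟩
  rw [← isArithFrobAt_absGaloisRestrict_adicCompletionPrime_iff K w hq φl]
  have e : absGaloisRestrict K (w.adicCompletion K) φl = φ := hφl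
  rw [e]
  exact hφ

/-- (C3/C4-nat) ★ **The Frobenius-value relation is natural under every transition `semilocH η` of the semilocal tower**: if `c ∈ Lloc_w(n,k)` has value `b` at `φ̃` then
`H¹(res_w, η) c ∈ Lloc_w(n′,k′)` has value `η b` (generic `IsFrobValue.map`; `semilocH η 1 = H¹((res_w)^* η)` definitionally). [cite: SerreGaloisCohomology1997, I §2.6]
[cite: NeukirchSchmidtWingberg2008, I §5 (1.5.2)] -/
theorem isFrobValue_semilocH {n n' k k' : ℕ} (φl : absoluteGaloisGroup (w.adicCompletion K))
    (η : coindFin.{0, 0} (coeffRepK S θ' P k).toTopRep (κ.layerSubgroup n) ⟶ coindFin.{0, 0} (coeffRepK S θ' P k').toTopRep (κ.layerSubgroup n'))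
    {c : semilocCoh S κ θ' P w n k 1} {b : absoluteGaloisGroup K ⧸ κ.layerSubgroup n → ↥(Representation.invariants ((muTwistO S θ' k).toRepresentation.comp (ramificationSubgroup K P).subtype))}
    (h : IsFrobValue (semilocGalRep S κ θ' P w n k) φl c b) :
    IsFrobValue (semilocGalRep S κ θ' P w n' k') φl (semilocH S κ θ' P w η 1 c) (η.hom b) :=
  IsFrobValue.map (τ := semilocGalRep S κ θ' P w n k) (τ' := semilocGalRep S κ θ' P w n' k')
    ((TopRep.resFunctor (resGalOfEmb (closureEmb (K := K) (w.adicCompletion K)) : absoluteGaloisGroup (w.adicCompletion K) →* absoluteGaloisGroup K)).map η) h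

/-- Naturality under the `𝒪`-scalars: `semilocScalar a c` has value `(a ⊗ id) ∘ b`. [cite: JohnsonLeungKings2011, §4.1 Def. 4.1] -/
theorem isFrobValue_semilocScalar {n k : ℕ} (φl : absoluteGaloisGroup (w.adicCompletion K)) (a : padicCoeffIntegers S)
    {c : semilocCoh S κ θ' P w n k 1} {b : absoluteGaloisGroup K ⧸ κ.layerSubgroup n → ↥(Representation.invariants ((muTwistO S θ' k).toRepresentation.comp (ramificationSubgroup K P).subtype))}
    (h : IsFrobValue (semilocGalRep S κ θ' P w n k) φl c b) :
    IsFrobValue (semilocGalRep S κ θ' P w n k) φl (semilocScalar S κ θ' P w n k 1 a c)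
      (fun y ↦ coeffMapO S P θ' (oMuScalar S (p ^ k) a) (oMuScalar_muTwistO S θ' k a) (b y)) :=
  isFrobValue_semilocH S κ θ' P w φl _ h

/-- Naturality under conjugation: `semilocConj γ c` has value `R_{γU_n} b = (y ↦ b (y·γ))`. [cite: SerreLocalFields1979, VII §5] -/
theorem isFrobValue_semilocConj {n k : ℕ} (φl : absoluteGaloisGroup (w.adicCompletion K)) (γ : absoluteGaloisGroup K)
    {c : semilocCoh S κ θ' P w n k 1} {b : absoluteGaloisGroup K ⧸ κ.layerSubgroup n → ↥(Representation.invariants ((muTwistO S θ' k).toRepresentation.comp (ramificationSubgroup K P).subtype))}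
    (h : IsFrobValue (semilocGalRep S κ θ' P w n k) φl c b) :
    IsFrobValue (semilocGalRep S κ θ' P w n k) φl (semilocConj S κ θ' P w n k 1 γ c) (fun y ↦ b (y * (γ : absoluteGaloisGroup K ⧸ κ.layerSubgroup n))) :=
  isFrobValue_semilocH S κ θ' P w φl _ h

/-- Naturality under reduction: `semilocRed c` has value `red ∘ b`. [cite: Kato2004Asterisque, §8.2 (p. 180)] -/
theorem isFrobValue_semilocRed {n k : ℕ} (φl : absoluteGaloisGroup (w.adicCompletion K))
    {c : semilocCoh S κ θ' P w n (k + 1) 1} {b : absoluteGaloisGroup K ⧸ κ.layerSubgroup n → ↥(Representation.invariants ((muTwistO S θ' (k + 1)).toRepresentation.comp (ramificationSubgroup K P).subtype))}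
    (h : IsFrobValue (semilocGalRep S κ θ' P w n (k + 1)) φl c b) :
    IsFrobValue (semilocGalRep S κ θ' P w n k) φl (semilocRed S κ θ' P w n k 1 c)
      (fun y ↦ coeffMapO S P θ' (oMuRed S k) (oMuRed_muTwistO S θ' k) (b y)) :=
  isFrobValue_semilocH S κ θ' P w φl _ h

/-- Naturality under corestriction: `semilocCores c` has value the fibre sum `Σ_{π z = y} b z`. [cite: NeukirchSchmidtWingberg2008, I §5 Prop. (1.5.3)–(1.5.4)] -/
theorem isFrobValue_semilocCores {n k : ℕ} (φl : absoluteGaloisGroup (w.adicCompletion K))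
    {c : semilocCoh S κ θ' P w (n + 1) k 1} {b : absoluteGaloisGroup K ⧸ κ.layerSubgroup (n + 1) → ↥(Representation.invariants ((muTwistO S θ' k).toRepresentation.comp (ramificationSubgroup K P).subtype))}
    (h : IsFrobValue (semilocGalRep S κ θ' P w (n + 1) k) φl c b) :
    IsFrobValue (semilocGalRep S κ θ' P w n k) φl (semilocCores S κ θ' P w n k 1 c)
      (letI := layerQuotFintype κ (n + 1); (coindFinSum (coeffRepK S θ' P k).toTopRep (κ.layerSubgroup_antitone (Nat.le_succ n))).hom b) := by
  letI := layerQuotFintype κ (n + 1)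
  exact isFrobValue_semilocH S κ θ' P w φl _ h

/-- **Frobenius-valued classes lie in g26's `unramifiedLevelΛ`** (at `w ∉ P`). [cite: MilneADT2006, I §2] [cite: Rubin2000, App. B.3] -/
theorem mem_unramifiedLevelΛ_of_isFrobValue (γ : absoluteGaloisGroup K) (hw : w ∉ P) (hNP : ∀ n, ramificationSubgroup K P ≤ κ.layerSubgroup n) {n k : ℕ}
    (φl : absoluteGaloisGroup (w.adicCompletion K)) {c : semilocCoh S κ θ' P w n k 1}
    {b : absoluteGaloisGroup K ⧸ κ.layerSubgroup n → ↥(Representation.invariants ((muTwistO S θ' k).toRepresentation.comp (ramificationSubgroup K P).subtype))}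
    (h : IsFrobValue (semilocGalRep S κ θ' P w n k) φl c b) : c ∈ unramifiedLevelΛ S κ γ θ' P w n k :=
  (mem_unramifiedLevelΛ_iff S κ γ θ' P w n k c).2 (h.mem_unramifiedSubgroup (semilocGalRep_apply_eq_self_of_mem_absInertia S κ θ' P w hw hNP n k))

/-- **Every `b` is the value of a class of `Lloc_w(n,k)`** (at `w ∉ P`, `φ̃` of Frobenius degree one). [cite: SerreLocalFields1979, XIII §1 Prop. 1] -/
theorem exists_isFrobValue_semiloc [FiniteDimensional ℚ_[p] (padicCoeffField S)] (hw : w ∉ P) (hNP : ∀ n, ramificationSubgroup K P ≤ κ.layerSubgroup n) (n k : ℕ)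
    {φl : absoluteGaloisGroup (w.adicCompletion K)} (hφl : IsFrobPow φl 1)
    (b : absoluteGaloisGroup K ⧸ κ.layerSubgroup n → ↥(Representation.invariants ((muTwistO S θ' k).toRepresentation.comp (ramificationSubgroup K P).subtype))) :
    ∃ c : semilocCoh S κ θ' P w n k 1, IsFrobValue (semilocGalRep S κ θ' P w n k) φl c b := by
  haveI := finite_semilocCoeff S κ θ' P n k
  exact exists_isFrobValue (semilocGalRep S κ θ' P w n k) φl (semilocGalRep_apply_eq_self_of_mem_absInertia S κ θ' P w hw hNP n k) hφl b

/-- **Two classes of `Lloc_w(n,k)` with values `b`, `b′` agree iff `b − b′ ∈ (φ̃ − 1)·Maps(Γ_K ⧸ U_n, X_k)`.** [cite: SerreLocalFields1979, XIII §1 Prop. 1] -/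
theorem isFrobValue_semiloc_eq_iff [FiniteDimensional ℚ_[p] (padicCoeffField S)] (hw : w ∉ P) (hNP : ∀ n, ramificationSubgroup K P ≤ κ.layerSubgroup n) {n k : ℕ}
    {φl : absoluteGaloisGroup (w.adicCompletion K)} (hφl : IsFrobPow φl 1) {c c' : semilocCoh S κ θ' P w n k 1}
    {b b' : absoluteGaloisGroup K ⧸ κ.layerSubgroup n → ↥(Representation.invariants ((muTwistO S θ' k).toRepresentation.comp (ramificationSubgroup K P).subtype))}
    (h : IsFrobValue (semilocGalRep S κ θ' P w n k) φl c b) (h' : IsFrobValue (semilocGalRep S κ θ' P w n k) φl c' b') :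
    c = c' ↔ ∃ y, b - b' = semilocGalRep S κ θ' P w n k φl y - y := by
  haveI := finite_semilocCoeff S κ θ' P n k
  exact h.eq_iff (semilocGalRep_apply_eq_self_of_mem_absInertia S κ θ' P w hw hNP n k) hφl h'

/-- **The class with a given value is unique.** [cite: SerreLocalFields1979, XIII §1 Prop. 1] -/
theorem isFrobValue_semiloc_eq_of_eq [FiniteDimensional ℚ_[p] (padicCoeffField S)] (hw : w ∉ P) (hNP : ∀ n, ramificationSubgroup K P ≤ κ.layerSubgroup n) {n k : ℕ}
    {φl : absoluteGaloisGroup (w.adicCompletion K)} (hφl : IsFrobPow φl 1) {c c' : semilocCoh S κ θ' P w n k 1}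
    {b : absoluteGaloisGroup K ⧸ κ.layerSubgroup n → ↥(Representation.invariants ((muTwistO S θ' k).toRepresentation.comp (ramificationSubgroup K P).subtype))}
    (h : IsFrobValue (semilocGalRep S κ θ' P w n k) φl c b) (h' : IsFrobValue (semilocGalRep S κ θ' P w n k) φl c' b) : c = c' := by
  haveI := finite_semilocCoeff S κ θ' P n k
  exact h.eq_of_eq (semilocGalRep_apply_eq_self_of_mem_absInertia S κ θ' P w hw hNP n k) hφl h'

end Level

end Summit.BirchSwinnertonDyer.BirchSwinnertonDyer.Theorems.SmallImageRttD2Seq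

end
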